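import Literature.NumberTheory.Transcendental.KZCalculus
import Literature.NumberTheory.Transcendental.SemialgebraicMapsProofs
import Literature.NumberTheory.Transcendental.SemialgebraicLineDeriv
import Summits.KontsevichZagierPeriods.KontsevichZagierPeriods.Theorems.RealOnePeriodRelations.Negative.Kit

/-!
# `RealOnePeriodRelations` (stmt-KontsevichZagierPeriods-10042), line `nash-retraction-thin-strip`:
# stub `stub_greenOnSquare` — helpers 1 (reflection kit, rule-1b kit, edge representations,
# point-reflected Green data)

Helper file 1 of the stub `stub_greenOnSquare` (the main file is
`Theorems/SymplecticScissorsRealOnePeriodRelationsGreenOnSquare.lean`); registered anchor: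
`helper_greenOnSquare_1` (rule 2 with the reflection `t ↦ 1 − t` of the unit interval).

For typed Green data `(A, B, S)` on the unit square `Q = [0,1]²` (`A, B` `ℚ`-semialgebraic and
continuous on `Q`, `dS = A da + B db` on the open square) with `B(0,·) = B(1,·) = 0` on `(0,1)`, the
bottom and top edge representations agree modulo
`closure (domainAddRel ∪ integrandAddRel ∪ changeOfVariablesRel ∪ Green)`:
`[∫₀¹ A(t,0) dt] − [∫₀¹ A(t,1) dt]` is a `ℤ`-combination of TWO typed Green generators (on the
standard triangle `Δ` with the data `(A, B, S)` itself, and on `Δ` with the point-reflected data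
`(−A∘σ, −B∘σ, S∘σ)`, `σ(a,b) = (1−a, 1−b)`), two rule-2 moves (the reflection `t ↦ 1 − t` of the
unit interval, identifying the two hypotenuse densities and the two top-edge densities) and rule-1b
moves (antipodal integrands sum to zero; the zero representation is a relation).

References: M. Kontsevich, D. Zagier, *Periods* (2001), §1.2.
-/

noncomputable section

open scoped BigOperators
open Set MeasureTheory
open Literature.NumberTheory.Transcendental
open Literature.ModelTheory.ExponentialFields (IsSemialgebraic)
open Summit.KontsevichZagierPeriods.SymplecticScissors.RealOnePeriodRelationsNegative
  (Δ unitDom isSemialgebraic_unitDom constRep₁ constRep₁_domain constRep₁_integrand)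

namespace Summit.KontsevichZagierPeriods.SymplecticScissors.RealOnePeriodRelations

/-! ## The reflection `t ↦ 1 − t` of the unit interval (rule 2 data on `ℝ¹`) -/

/-- The reflection `z ↦ (1 − z₀)` of `ℝ¹` has derivative `(−1) • id` everywhere. [folklore] -/
theorem gsq_hasFDerivAt_reflect (p : Fin 1 → ℝ) :
    HasFDerivAt (fun z : Fin 1 → ℝ => fun _ : Fin 1 => 1 - z 0)
      ((-1 : ℝ) • ContinuousLinearMap.id ℝ (Fin 1 → ℝ)) p := by
  -- adapted from `hasFDerivAt_fin_one` (Theorems/HermiteRigidityGenusTwoCycleTransferPushforwardDimOne.lean)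
  have h0 : HasFDerivAt (fun q : Fin 1 → ℝ => q 0)
      (ContinuousLinearMap.proj (R := ℝ) (φ := fun _ : Fin 1 => ℝ) 0) p :=
    hasFDerivAt_apply (𝕜 := ℝ) 0 p
  have h1 : HasFDerivAt (fun q : Fin 1 → ℝ => (1 : ℝ) - q 0)
      (-(ContinuousLinearMap.proj (R := ℝ) (φ := fun _ : Fin 1 => ℝ) 0)) p := h0.const_sub 1
  have h2 : HasFDerivAt (fun (q : Fin 1 → ℝ) (_ : Fin 1) => (1 : ℝ) - q 0)
      (ContinuousLinearMap.pi fun _ : Fin 1 =>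
        -(ContinuousLinearMap.proj (R := ℝ) (φ := fun _ : Fin 1 => ℝ) 0)) p :=
    hasFDerivAt_pi.mpr fun _ => h1
  refine h2.congr_fderiv ?_
  ext v i
  simp [Fin.fin_one_eq_zero i]

/-- The reflection maps the open unit interval onto itself. [folklore] -/
theorem gsq_reflect_image :
    (fun z : Fin 1 → ℝ => fun _ : Fin 1 => 1 - z 0) '' unitDom = unitDom := by
  ext w
  simp only [mem_image, unitDom, mem_setOf_eq, mem_Ioo]
  constructor
  · rintro ⟨z, ⟨h0, h1⟩, rfl⟩
    constructor <;> dsimp only <;> linarith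
  · rintro ⟨h0, h1⟩
    refine ⟨fun _ => 1 - w 0, ⟨by linarith, by linarith⟩, ?_⟩
    funext i
    rw [Fin.fin_one_eq_zero i]
    simp

/-- The reflection is injective on the unit interval. [folklore] -/
theorem gsq_reflect_injOn : InjOn (fun z : Fin 1 → ℝ => fun _ : Fin 1 => 1 - z 0) unitDom := by
  intro x _ y _ h
  have h0 : (1 : ℝ) - x 0 = 1 - y 0 := congr_fun h 0
  funext i
  rw [Fin.fin_one_eq_zero i]
  linarith

/-- The reflection is a `ℚ`-semialgebraic (polynomial) map on the unit interval. [folklore] -/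
theorem gsq_reflect_isSemialgebraicMapOn :
    IsSemialgebraicMapOn ℚ unitDom (fun z : Fin 1 → ℝ => fun _ : Fin 1 => 1 - z 0) :=
  IsSemialgebraicMapOn.of_forall isSemialgebraic_unitDom fun _ =>
    (isSemialgebraicFunOn_aeval isSemialgebraic_unitDom
      (1 - MvPolynomial.X 0 : MvPolynomial (Fin 1) ℚ)).congr fun z _ => by simp

/-- The reflection maps the open unit interval into itself. [folklore] -/
theorem gsq_reflect_mapsTo :
    MapsTo (fun z : Fin 1 → ℝ => fun _ : Fin 1 => 1 - z 0) unitDom unitDom := by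
  intro z hz
  simp only [unitDom, mem_setOf_eq, mem_Ioo] at hz ⊢
  constructor <;> linarith

/-- The reflection maps the closed unit interval into itself. [folklore] -/
theorem gsq_reflect_mapsTo_Icc :
    MapsTo (fun z : Fin 1 → ℝ => fun _ : Fin 1 => 1 - z 0) {z | z 0 ∈ Icc (0 : ℝ) 1}
      {z | z 0 ∈ Icc (0 : ℝ) 1} := by
  intro z hz
  simp only [mem_setOf_eq, mem_Icc] at hz ⊢
  constructor <;> linarith

/-- The reflection is continuous. [folklore] -/
theorem gsq_reflect_continuous : Continuous (fun z : Fin 1 → ℝ => fun _ : Fin 1 => 1 - z 0) :=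
  continuous_pi fun _ => continuous_const.sub (continuous_apply 0)

/-- **Rule 2 with `t ↦ 1 − t`.** Two representations on the unit interval whose integrands are
reflections of each other differ by a change-of-variables move. [cite: KontsevichZagier2001, §1.2 rule (2)] -/
theorem gsq_reflect_cov (r r' : KZ.IntegralRep 1) (hr : r.domain = unitDom)
    (hr' : r'.domain = unitDom)
    (h : ∀ z ∈ unitDom, r.integrand z = r'.integrand (fun _ => 1 - z 0)) :
    KZ.of r - KZ.of r' ∈ KZ.changeOfVariablesRel := by
  refine ⟨1, r, r', fun z _ => 1 - z 0, fun _ => (-1 : ℝ) • ContinuousLinearMap.id ℝ (Fin 1 → ℝ),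
    ?_, ?_, ?_, ?_, ?_, rfl⟩
  · rw [hr]; exact gsq_reflect_isSemialgebraicMapOn
  · intro x _; exact (gsq_hasFDerivAt_reflect x).hasFDerivWithinAt
  · rw [hr]; exact gsq_reflect_injOn
  · rw [hr, hr', gsq_reflect_image]
  · intro x hx
    rw [hr] at hx
    -- `det ((-1) • id) = -1` on `ℝ¹` (adapted from `det_smul_id_fin_one`,
    -- Theorems/HermiteRigidityGenusTwoCycleTransferPushforwardDimOne.lean)
    have hdet : ((-1 : ℝ) • ContinuousLinearMap.id ℝ (Fin 1 → ℝ)).det = -1 := by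
      rw [ContinuousLinearMap.det, ContinuousLinearMap.toLinearMap_smul,
        ContinuousLinearMap.coe_id, LinearMap.det_smul, LinearMap.det_id,
        Module.finrank_fintype_fun_eq_card, Fintype.card_fin]
      ring
    rw [hdet, h x hx]
    simp

/-! ## Rule 1b: the zero representation and antipodal integrands -/

/-- The zero representation `[∫_{(0,1)} 0]` lies in the move subgroup (`[z] − [z] − [z]` is an
integrand-additivity move). [cite: KontsevichZagier2001, §1.2 rule (1)] -/
theorem gsq_zero_mem (G : Set KZ.FormalRep) :
    KZ.of (constRep₁ 0) ∈ AddSubgroup.closure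
      (KZ.domainAddRel ∪ KZ.integrandAddRel ∪ KZ.changeOfVariablesRel ∪ G) := by
  set M := AddSubgroup.closure
    (KZ.domainAddRel ∪ KZ.integrandAddRel ∪ KZ.changeOfVariablesRel ∪ G)
  have h : KZ.of (constRep₁ 0) - KZ.of (constRep₁ 0) - KZ.of (constRep₁ 0) ∈ M :=
    AddSubgroup.subset_closure (Or.inl (Or.inl (Or.inr
      ⟨1, constRep₁ 0, constRep₁ 0, constRep₁ 0, rfl, rfl, fun x _ => by simp, rfl⟩)))
  rw [sub_self, zero_sub] at h
  simpa using M.neg_mem h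

/-- Two representations on the unit interval with antipodal integrands sum to an element of the
move subgroup (rule 1b against the zero representation). [cite: KontsevichZagier2001, §1.2 rule (1)] -/
theorem gsq_add_mem_of_antipodal (G : Set KZ.FormalRep) (r r' : KZ.IntegralRep 1)
    (hr : r.domain = unitDom) (hr' : r'.domain = unitDom)
    (h : ∀ z ∈ unitDom, r.integrand z + r'.integrand z = 0) :
    KZ.of r + KZ.of r' ∈ AddSubgroup.closure
      (KZ.domainAddRel ∪ KZ.integrandAddRel ∪ KZ.changeOfVariablesRel ∪ G) := by
  set M := AddSubgroup.closure
    (KZ.domainAddRel ∪ KZ.integrandAddRel ∪ KZ.changeOfVariablesRel ∪ G)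
  have h1 : KZ.of (constRep₁ 0) - KZ.of r - KZ.of r' ∈ M := by
    refine AddSubgroup.subset_closure (Or.inl (Or.inl (Or.inr
      ⟨1, constRep₁ 0, r, r', hr, hr', fun x hx => ?_, rfl⟩)))
    have hx' : x ∈ unitDom := hx
    simp only [Pi.add_apply, constRep₁_integrand, Rat.cast_zero]
    exact (h x hx').symm
  have h2 : KZ.of (constRep₁ 0) ∈ M := gsq_zero_mem G
  have h3 : KZ.of r + KZ.of r' =
      KZ.of (constRep₁ 0) - (KZ.of (constRep₁ 0) - KZ.of r - KZ.of r') := by abel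
  rw [h3]
  exact M.sub_mem h2 h1

/-! ## Edge representations on the unit interval -/

/-- The standard triangle `Δ` is `ℚ`-semialgebraic. [folklore] -/
theorem gsq_isSemialgebraic_Δ : IsSemialgebraic ℚ Δ := by
  -- adapted from Cruxes/RealOnePeriodRelations/Disproof.lean
  have h0 := Literature.ModelTheory.ExponentialFields.isSemialgebraic_setOf_eval_nonneg (k := ℚ)
    (R := ℝ) (MvPolynomial.X (0 : Fin 2) : MvPolynomial (Fin 2) ℚ)
  have h1 := Literature.ModelTheory.ExponentialFields.isSemialgebraic_setOf_eval_nonneg (k := ℚ)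
    (R := ℝ) (MvPolynomial.X (1 : Fin 2) : MvPolynomial (Fin 2) ℚ)
  have h2 := Literature.ModelTheory.ExponentialFields.isSemialgebraic_setOf_eval_le (k := ℚ)
    (R := ℝ) (MvPolynomial.X (0 : Fin 2) + MvPolynomial.X 1 : MvPolynomial (Fin 2) ℚ) 1
  have hΔ : Δ = ({x : Fin 2 → ℝ | 0 ≤ MvPolynomial.aeval x
      (MvPolynomial.X (0 : Fin 2) : MvPolynomial (Fin 2) ℚ)} ∩
      {x : Fin 2 → ℝ | 0 ≤ MvPolynomial.aeval x
        (MvPolynomial.X (1 : Fin 2) : MvPolynomial (Fin 2) ℚ)}) ∩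
      {x : Fin 2 → ℝ | MvPolynomial.aeval x
        (MvPolynomial.X (0 : Fin 2) + MvPolynomial.X 1 : MvPolynomial (Fin 2) ℚ) ≤
        MvPolynomial.aeval x (1 : MvPolynomial (Fin 2) ℚ)} := by
    ext p
    simp [Δ, and_assoc]
  rw [hΔ]
  exact (h0.inter h1).inter h2

/-- Pairs of continuous real functions give continuous maps to `ℝ²`. [folklore] -/
theorem gsq_continuous_vec2 {X : Type*} [TopologicalSpace X] {u v : X → ℝ}
    (hu : Continuous u) (hv : Continuous v) : Continuous fun x => ![u x, v x] := by
  refine continuous_pi fun i => ?_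
  fin_cases i
  · simpa using hu
  · simpa using hv

/-- The top edge `t ↦ (t, 1)` is a `ℚ`-polynomial map on the unit interval. [folklore] -/
theorem gsq_isSemialgebraicMapOn_top :
    IsSemialgebraicMapOn ℚ unitDom (fun z : Fin 1 → ℝ => ![z 0, 1]) :=
  (isSemialgebraicMapOn_aeval isSemialgebraic_unitDom
    (![MvPolynomial.X 0, 1] : Fin 2 → MvPolynomial (Fin 1) ℚ)).congr fun z _ => by
    ext j; fin_cases j <;> simp

/-- The hypotenuse `t ↦ (1 − t, t)` is a `ℚ`-polynomial map on the unit interval. [folklore] -/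
theorem gsq_isSemialgebraicMapOn_hyp :
    IsSemialgebraicMapOn ℚ unitDom (fun z : Fin 1 → ℝ => ![1 - z 0, z 0]) :=
  (isSemialgebraicMapOn_aeval isSemialgebraic_unitDom
    (![1 - MvPolynomial.X 0, MvPolynomial.X 0] : Fin 2 → MvPolynomial (Fin 1) ℚ)).congr
    fun z _ => by
    ext j; fin_cases j <;> simp

/-- The reflected top edge `t ↦ (1 − t, 1)` is a `ℚ`-polynomial map on the unit interval.
[folklore] -/
theorem gsq_isSemialgebraicMapOn_topReflected :
    IsSemialgebraicMapOn ℚ unitDom (fun z : Fin 1 → ℝ => ![1 - z 0, 1]) :=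
  (isSemialgebraicMapOn_aeval isSemialgebraic_unitDom
    (![1 - MvPolynomial.X 0, 1] : Fin 2 → MvPolynomial (Fin 1) ℚ)).congr fun z _ => by
    ext j; fin_cases j <;> simp

/-- A function continuous on the closed unit interval `{z | z₀ ∈ [0,1]} ⊂ ℝ¹` is integrable on the
open unit interval `unitDom`. [folklore] -/
theorem gsq_integrableOn_unitDom {g : (Fin 1 → ℝ) → ℝ}
    (hg : ContinuousOn g {z | z 0 ∈ Icc (0 : ℝ) 1}) : IntegrableOn g unitDom := by
  have hI : {z : Fin 1 → ℝ | z 0 ∈ Icc (0 : ℝ) 1} = Icc (0 : Fin 1 → ℝ) 1 := by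
    ext z
    simp only [mem_setOf_eq, mem_Icc, Pi.le_def, Fin.forall_fin_one, Pi.zero_apply, Pi.one_apply]
  rw [hI] at hg
  refine (hg.integrableOn_Icc).mono_set fun z hz => ?_
  simp only [unitDom, mem_setOf_eq, mem_Ioo] at hz
  simp only [mem_Icc, Pi.le_def, Fin.forall_fin_one, Pi.zero_apply, Pi.one_apply]
  exact ⟨hz.1.le, hz.2.le⟩

/-- Edge traces `z ↦ F (e z)` of a function `F` which is `ℚ`-semialgebraic and continuous on a
set `Q ⊆ ℝ²`, along a `ℚ`-semialgebraic continuous edge `e : ℝ¹ → Q`, are `ℚ`-semialgebraic on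
the open unit interval and continuous on the closed one. [cite: BochnakCosteRoy1998, Prop. 2.2.6] -/
theorem gsq_edge_trace {Q : Set (Fin 2 → ℝ)} {F : (Fin 2 → ℝ) → ℝ}
    {e : (Fin 1 → ℝ) → (Fin 2 → ℝ)} (hF : IsSemialgebraicFunOn ℚ Q F) (hFc : ContinuousOn F Q)
    (he : IsSemialgebraicMapOn ℚ unitDom e) (hec : Continuous e)
    (hmaps : ∀ z : Fin 1 → ℝ, z 0 ∈ Icc (0 : ℝ) 1 → e z ∈ Q) :
    IsSemialgebraicFunOn ℚ unitDom (fun z => F (e z)) ∧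
      ContinuousOn (fun z => F (e z)) {z | z 0 ∈ Icc (0 : ℝ) 1} :=
  ⟨IsSemialgebraicFunOn.comp_isSemialgebraicMapOn_holds hF he fun z hz =>
      hmaps z (Ioo_subset_Icc_self hz),
    hFc.comp hec.continuousOn fun z hz => hmaps z hz⟩

/-- Every `ℚ`-semialgebraic function on the open unit interval which is continuous on the closed
unit interval is the integrand of an integral representation with domain `unitDom`. [folklore] -/
theorem gsq_exists_rep {g : (Fin 1 → ℝ) → ℝ} (hg : IsSemialgebraicFunOn ℚ unitDom g)
    (hgc : ContinuousOn g {z | z 0 ∈ Icc (0 : ℝ) 1}) :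
    ∃ r : KZ.IntegralRep 1, r.domain = unitDom ∧ r.integrand = g :=
  ⟨⟨unitDom, g, isSemialgebraic_unitDom, hg, gsq_integrableOn_unitDom hgc⟩, rfl, rfl⟩

/-! ## The point-reflected Green data on the standard triangle -/

/-- The point reflection `σ(a,b) = (1 − a, 1 − b)` has derivative `−id`. [folklore] -/
theorem gsq_hasFDerivAt_pointReflect (p : Fin 2 → ℝ) :
    HasFDerivAt (fun p : Fin 2 → ℝ => ![1 - p 0, 1 - p 1])
      (-(ContinuousLinearMap.id ℝ (Fin 2 → ℝ))) p := by
  have hfun : (fun p : Fin 2 → ℝ => ![1 - p 0, 1 - p 1]) = fun p => ![(1 : ℝ), 1] - p := by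
    funext q; ext i; fin_cases i <;> simp
  rw [hfun]
  exact (hasFDerivAt_id p).const_sub _

/-- **Point-reflected Green data.** If `(A, B, S)` are typed Green data on the unit square `Q`
(`A, B` `ℚ`-semialgebraic and continuous on `Q`, `dS = A da + B db` on the open square), then
`(−A∘σ, −B∘σ, S∘σ)` with `σ(a,b) = (1−a, 1−b)` are typed Green data on the standard triangle `Δ`
(`σ` maps `Δ` into `Q` and the open triangle into the open square; chain rule with `Dσ = −id`).
[cite: KontsevichZagier2001, §1.2] -/
theorem gsq_reflected_data {Q : Set (Fin 2 → ℝ)}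
    (hQ : Q = {p | 0 ≤ p 0 ∧ p 0 ≤ 1 ∧ 0 ≤ p 1 ∧ p 1 ≤ 1}) {A B S : (Fin 2 → ℝ) → ℝ}
    (hA : IsSemialgebraicFunOn ℚ Q A) (hB : IsSemialgebraicFunOn ℚ Q B)
    (hAc : ContinuousOn A Q) (hBc : ContinuousOn B Q)
    (hS : ∀ p : Fin 2 → ℝ, 0 < p 0 → p 0 < 1 → 0 < p 1 → p 1 < 1 →
      HasFDerivAt S (A p • ContinuousLinearMap.proj (R := ℝ) (φ := fun _ : Fin 2 => ℝ) 0 +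
        B p • ContinuousLinearMap.proj (R := ℝ) (φ := fun _ : Fin 2 => ℝ) 1) p) :
    IsSemialgebraicFunOn ℚ Δ (fun p => -A ![1 - p 0, 1 - p 1]) ∧
    IsSemialgebraicFunOn ℚ Δ (fun p => -B ![1 - p 0, 1 - p 1]) ∧
    ContinuousOn (fun p => -A ![1 - p 0, 1 - p 1]) Δ ∧
    ContinuousOn (fun p => -B ![1 - p 0, 1 - p 1]) Δ ∧
    (∀ p : Fin 2 → ℝ, 0 < p 0 → 0 < p 1 → p 0 + p 1 < 1 →
      HasFDerivAt (fun p => S ![1 - p 0, 1 - p 1])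
        ((-A ![1 - p 0, 1 - p 1]) • ContinuousLinearMap.proj (R := ℝ) (φ := fun _ : Fin 2 => ℝ) 0 +
          (-B ![1 - p 0, 1 - p 1]) •
            ContinuousLinearMap.proj (R := ℝ) (φ := fun _ : Fin 2 => ℝ) 1) p) := by
  have hσ : IsSemialgebraicMapOn ℚ Δ (fun p : Fin 2 → ℝ => ![1 - p 0, 1 - p 1]) :=
    (isSemialgebraicMapOn_aeval gsq_isSemialgebraic_Δ
      (![1 - MvPolynomial.X 0, 1 - MvPolynomial.X 1] : Fin 2 → MvPolynomial (Fin 2) ℚ)).congr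
      fun p _ => by
      ext j; fin_cases j <;> simp
  have hmaps : MapsTo (fun p : Fin 2 → ℝ => ![1 - p 0, 1 - p 1]) Δ Q := by
    intro p hp
    obtain ⟨h0, h1, h2⟩ := hp
    rw [hQ]
    simp only [mem_setOf_eq, Matrix.cons_val_zero, Matrix.cons_val_one, Matrix.cons_val_fin_one]
    refine ⟨?_, ?_, ?_, ?_⟩ <;> linarith
  have hσc : Continuous (fun p : Fin 2 → ℝ => ![1 - p 0, 1 - p 1]) :=
    gsq_continuous_vec2 (continuous_const.sub (continuous_apply 0))
      (continuous_const.sub (continuous_apply 1))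
  have hA' : IsSemialgebraicFunOn ℚ Δ (fun p => A ![1 - p 0, 1 - p 1]) :=
    IsSemialgebraicFunOn.comp_isSemialgebraicMapOn_holds hA hσ hmaps
  have hB' : IsSemialgebraicFunOn ℚ Δ (fun p => B ![1 - p 0, 1 - p 1]) :=
    IsSemialgebraicFunOn.comp_isSemialgebraicMapOn_holds hB hσ hmaps
  have hAc' : ContinuousOn (fun p => A ![1 - p 0, 1 - p 1]) Δ := hAc.comp hσc.continuousOn hmaps
  have hBc' : ContinuousOn (fun p => B ![1 - p 0, 1 - p 1]) Δ := hBc.comp hσc.continuousOn hmaps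
  refine ⟨hA'.fun_neg, hB'.fun_neg, hAc'.neg, hBc'.neg, fun p h0 h1 h2 => ?_⟩
  have hSd := hS ![1 - p 0, 1 - p 1]
    (by simp only [Matrix.cons_val_zero]; linarith)
    (by simp only [Matrix.cons_val_zero]; linarith)
    (by simp only [Matrix.cons_val_one, Matrix.cons_val_fin_one]; linarith)
    (by simp only [Matrix.cons_val_one, Matrix.cons_val_fin_one]; linarith)
  refine (hSd.comp p (gsq_hasFDerivAt_pointReflect p)).congr_fderiv ?_
  ext v
  simp [add_comm]

/-! ## Registered anchor -/

/-- **Anchor `helper_greenOnSquare_1`** (registered helper stub of `stub_greenOnSquare`): rule 2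
with the reflection `t ↦ 1 − t` — two representations on the open unit interval whose integrands
are reflections of each other differ by ONE change-of-variables move.
[cite: KontsevichZagier2001, §1.2 rule (2)] -/
theorem helper_greenOnSquare_1 : ∀ (r r' : KZ.IntegralRep 1), r.domain = {z | z 0 ∈ Set.Ioo (0 : ℝ) 1} → r'.domain = {z | z 0 ∈ Set.Ioo (0 : ℝ) 1} → (∀ z : Fin 1 → ℝ, z 0 ∈ Set.Ioo (0 : ℝ) 1 → r.integrand z = r'.integrand (fun _ => 1 - z 0)) → KZ.of r - KZ.of r' ∈ KZ.changeOfVariablesRel :=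
  fun r r' hr hr' h => gsq_reflect_cov r r' hr hr' fun z hz => h z hz

end Summit.KontsevichZagierPeriods.SymplecticScissors.RealOnePeriodRelations

end
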